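import Literature.NumberTheory.GaloisRepresentations.LubinTateColemanTwoVariableLimitTwo
import HarnessLib

/-!
# The cokernel of de Shalit's limit sequence (17) over the unramified tower at `q = 2` is PRO-CYCLIC over `𝒪_F`:
# `lim←_m 𝒪_{E_m}/(1 − uφ)𝒪_{E_m} = 𝒪_F · g`

De Shalit, *Iwasawa theory of elliptic curves with complex multiplication* (1987), Ch. I §3.7–3.8: the cokernel of (13) over `k′` is
`(𝒪/p^N)(1)`, `p^N ∥ p^dξ^{-1} − 1`, and in the limit (17) over `k′ ⊂ k″ ⊂ ⋯ ⊂ k^{ur}` it becomes `𝒪(1)` — in any case a CYCLIC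
`𝒪`-module (Ch. III §1.10: "`Λ/Λ₁` is pseudo-null", which in two variables is `Λ/Λ₁` finitely generated over the coefficient ring;
memo `BRICK-C-NORM-g7.md` §2 (c)).  With the levelwise identification `𝒪_{E_m}/(1 − uφ)𝒪_{E_m} ≅ 𝒪_F/(1 − u^{[E_m:F]})`
(`exists_functional_anomaly_cokernel`) and the surjectivity of the unramified traces this file proves, for a tower `E₀ ≤ E₁ ≤ ⋯ ⊆ F^{nr}`
of finite Galois extensions and `u ∈ 𝒪_F` with `u^{[E_m:F]} ≠ 1` for all `m`:

* `finrank_dvd_of_le`, `one_sub_pow_finrank_dvd` — `[E_m:F] ∣ [E_{m'}:F]` and `1 − u^{[E_m:F]} ∣ 1 − u^{[E_{m'}:F]}` for `m ≤ m'`;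
* ★ `exists_unit_functional_transition` — along `E₁ ≤ E₂` the functionals `λ_i` of the two levels satisfy
  `λ₁(Tr x) ≡ w·λ₂(x) (mod 1 − u^{[E₁:F]})` for a UNIT `w ∈ 𝒪_F^×` (the transition map `𝒪_F/(1 − u^{d₂}) → 𝒪_F/(1 − u^{d₁})` of the
  cokernel system is a unit multiple of the projection);
* ★★★ `exists_generator_cokernel_limit` — **there is a family `g = (g_m ∈ 𝒪_{E_m})`, trace-coherent modulo the `(1 − uφ)𝒪_{E_m}`, such
  that EVERY family `c` trace-coherent modulo the `(1 − uφ)𝒪_{E_m}` is `≡ a·g` for one scalar `a ∈ 𝒪_F`**: the limit of the cokernels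
  is the cyclic `𝒪_F`-module `𝒪_F·g ≅ lim←_m 𝒪_F/(1 − u^{[E_m:F]})` (the scalar is found by Cantor's intersection theorem in the compact
  `𝒪_F`).  So the coordinate map `r_∞ : 𝒰¹_∞ ↪ lim←_{Tr} 𝒪_{E_m}⟦Y⟧` of `LubinTateColemanTwoVariableLimitTwo` has a cokernel generated
  by ONE element over `𝒪_F` — as good as an isomorphism for characteristic ideals in two variables.

Everything PROVED (0 sorry, no named facts, no new definitions).

## References

* E. de Shalit, *Iwasawa theory of elliptic curves with complex multiplication* (1987), Ch. I §3.7 Theorem, §3.8 (16)–(17); Ch. III §1.10. [deShalit1987]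
-/

noncomputable section

namespace Literature.NumberTheory.GaloisRepresentations

section TwoVariableCokernelTwo

open GaloisRepresentations.IsNonarchimedeanLocalField LubinTate ValuativeRel Field

variable {F : Type} [Field F] [ValuativeRel F] [TopologicalSpace F] [IsNonarchimedeanLocalField F]

attribute [local instance] ltNormUniformSpace ltNormIsUniformAddGroup rk1 nF nE fintypeResidueField

variable {π : 𝒪[F]} (hπ : (valuation F).IsUniformizer (π : F))

/-! ### Degrees and annihilators along the tower -/

omit [ValuativeRel F] [TopologicalSpace F] [IsNonarchimedeanLocalField F] in
/-- `[E₁:F] ∣ [E₂:F]` for `E₁ ≤ E₂` (tower law). [cite: SerreLocalFields1979, Ch. I §4] -/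
theorem finrank_dvd_of_le {E₁ E₂ : IntermediateField F (AlgebraicClosure F)} [FiniteDimensional F E₁] [FiniteDimensional F E₂]
    (h : E₁ ≤ E₂) : Module.finrank F E₁ ∣ Module.finrank F E₂ := by
  letI := towerAlgebra h
  haveI := towerAlgebra_isScalarTower h
  exact ⟨Module.finrank E₁ E₂, (Module.finrank_mul_finrank F E₁ E₂).symm⟩

omit [ValuativeRel F] [TopologicalSpace F] [IsNonarchimedeanLocalField F] in
/-- `1 − u^{[E₁:F]} ∣ 1 − u^{[E₂:F]}` for `E₁ ≤ E₂`: the annihilators of the cokernels decrease along the tower (the anomaly indices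
`N_m` increase). [cite: deShalit1987, Ch. I §3.7 Theorem] -/
theorem one_sub_pow_finrank_dvd {R : Type*} [CommRing R] {E₁ E₂ : IntermediateField F (AlgebraicClosure F)} [FiniteDimensional F E₁]
    [FiniteDimensional F E₂] (h : E₁ ≤ E₂) (u : R) : 1 - u ^ Module.finrank F E₁ ∣ 1 - u ^ Module.finrank F E₂ := by
  obtain ⟨k, hk⟩ := finrank_dvd_of_le h
  have h1 := sub_dvd_pow_sub_pow (1 : R) (u ^ Module.finrank F E₁) k
  rwa [one_pow, ← pow_mul, ← hk] at h1

/-- The two coefficient maps `LTCoeff F → 𝒪_E` and `𝒪_F → 𝒪_E` agree (bridge to the `LTCoeff`-currency of the coordinates `r_β`).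
[cite: deShalit1987, Ch. I §3.7 Theorem] -/
theorem algebraMap_LTCoeff_eq_algebraMap (E : IntermediateField F (AlgebraicClosure F)) [FiniteDimensional F E] (w : LTCoeff F) :
    algebraMap (LTCoeff F) (unitBall E) w = algebraMap 𝒪[F] (unitBall E) ((LTCoeff.of F).symm w) := by
  change algebraMap (LTCoeff F) (unitBall E) w = algebraMap (LTCoeff F) (unitBall E) ((LTCoeff.of F) ((LTCoeff.of F).symm w))
  rw [RingEquiv.apply_symm_apply]

/-! ### The transition maps of the cokernel system are unit multiples of the projections -/

variable {E₁ E₂ : IntermediateField F (AlgebraicClosure F)} [FiniteDimensional F E₁] [FiniteDimensional F E₂] [IsGalois F E₁] [IsGalois F E₂]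

/-- `Tr` maps `(1 − uφ)𝒪_{E₂}` into `(1 − uφ)𝒪_{E₁}` (`𝒪_F`-coefficient form of `exists_unitBallTrace_eq_sub_mul_frob`).
[cite: deShalit1987, Ch. I §3.8 (16)] -/
theorem exists_unitBallTrace_eq_sub_algebraMap_mul_frob (h : E₁ ≤ E₂) (σ₀ : absoluteGaloisGroup F) (u : 𝒪[F]) {x : unitBall E₂}
    (hx : ∃ d : unitBall E₂, x = d - algebraMap 𝒪[F] (unitBall E₂) u * (frobUnitBall E₂ σ₀ : unitBall E₂ →+* unitBall E₂) d) :
    ∃ d : unitBall E₁, unitBallTrace h x = d - algebraMap 𝒪[F] (unitBall E₁) u * (frobUnitBall E₁ σ₀ : unitBall E₁ →+* unitBall E₁) d := by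
  obtain ⟨d, rfl⟩ := hx
  refine ⟨unitBallTrace h d, ?_⟩
  rw [map_sub, ← Algebra.smul_def, map_smul, unitBallTrace_frobUnitBall, Algebra.smul_def]

omit [FiniteDimensional F E₁] [IsGalois F E₁] in
/-- `(1 − uφ)𝒪_E` is closed under subtraction. [cite: deShalit1987, Ch. I §3.7 Theorem] -/
theorem exists_sub_eq_sub_algebraMap_mul_frob [FiniteDimensional F E₁] [Normal F E₁] (σ₀ : absoluteGaloisGroup F) (u : 𝒪[F])
    {x y : unitBall E₁}
    (hx : ∃ d : unitBall E₁, x = d - algebraMap 𝒪[F] (unitBall E₁) u * (frobUnitBall E₁ σ₀ : unitBall E₁ →+* unitBall E₁) d)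
    (hy : ∃ d : unitBall E₁, y = d - algebraMap 𝒪[F] (unitBall E₁) u * (frobUnitBall E₁ σ₀ : unitBall E₁ →+* unitBall E₁) d) :
    ∃ d : unitBall E₁, x - y = d - algebraMap 𝒪[F] (unitBall E₁) u * (frobUnitBall E₁ σ₀ : unitBall E₁ →+* unitBall E₁) d := by
  obtain ⟨d, rfl⟩ := hx
  obtain ⟨d', rfl⟩ := hy
  exact ⟨d - d', by rw [map_sub]; ring⟩

include hπ in
set_option maxHeartbeats 400000 in
/-- ★ **The transition map of the cokernel system is a unit multiple of the projection**: for `E₁ ≤ E₂ ⊆ F^{nr}` finite Galois and the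
functionals `λ₁, λ₂` of `exists_functional_anomaly_cokernel` (`λ_i` onto, `x ∈ (1 − uφ)𝒪_{E_i} ⟺ λ_i x ∈ (1 − u^{d_i})`), there is a unit
`w ∈ 𝒪_F^×` with `λ₁(Tr x) − w·λ₂(x) ∈ (1 − u^{d₁})` for all `x ∈ 𝒪_{E₂}` (`w` = the image of `1`; a unit because `Tr` and `λ₁` are onto).
[cite: deShalit1987, Ch. I §3.8 (16)] -/
theorem exists_unit_functional_transition (h : E₁ ≤ E₂) (hE₂ : E₂ ≤ maxUnramified F) (σ₀ : absoluteGaloisGroup F) (u : 𝒪[F])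
    {lam₁ : unitBall E₁ →ₗ[𝒪[F]] 𝒪[F]} {lam₂ : unitBall E₂ →ₗ[𝒪[F]] 𝒪[F]} (hsurj₁ : Function.Surjective lam₁)
    (hiff₁ : ∀ c : unitBall E₁, (∃ c' : unitBall E₁, c = c' - algebraMap 𝒪[F] (unitBall E₁) u *
      (frobUnitBall E₁ σ₀ : unitBall E₁ →+* unitBall E₁) c') ↔ lam₁ c ∈ Ideal.span {1 - u ^ Module.finrank F E₁})
    (hsurj₂ : Function.Surjective lam₂)
    (hiff₂ : ∀ c : unitBall E₂, (∃ c' : unitBall E₂, c = c' - algebraMap 𝒪[F] (unitBall E₂) u *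
      (frobUnitBall E₂ σ₀ : unitBall E₂ →+* unitBall E₂) c') ↔ lam₂ c ∈ Ideal.span {1 - u ^ Module.finrank F E₂}) :
    ∃ w : 𝒪[F]ˣ, ∀ x : unitBall E₂, lam₁ (unitBallTrace h x) - (w : 𝒪[F]) * lam₂ x ∈ Ideal.span {1 - u ^ Module.finrank F E₁} := by
  obtain ⟨x₁, hx₁⟩ := hsurj₂ 1
  -- the candidate `w₀ = λ₁(Tr x₁)` works for the congruence
  have hcong : ∀ x : unitBall E₂, lam₁ (unitBallTrace h x) - lam₁ (unitBallTrace h x₁) * lam₂ x ∈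
      Ideal.span {1 - u ^ Module.finrank F E₁} := by
    intro x
    have hker : lam₂ (x - lam₂ x • x₁) ∈ Ideal.span {1 - u ^ Module.finrank F E₂} := by
      rw [map_sub, map_smul, hx₁, smul_eq_mul, mul_one, sub_self]
      exact zero_mem _
    obtain ⟨d, hd⟩ := exists_unitBallTrace_eq_sub_algebraMap_mul_frob h σ₀ u ((hiff₂ _).mpr hker)
    have hmem := (hiff₁ _).mp ⟨d, hd⟩
    rw [map_sub, map_smul, map_sub, map_smul, smul_eq_mul] at hmem
    rwa [mul_comm]
  by_cases hunit : IsUnit (1 - u ^ Module.finrank F E₁)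
  · -- everything is congruent: take `w = 1`
    refine ⟨1, fun x => ?_⟩
    rw [Ideal.span_singleton_eq_top.mpr hunit]
    exact Submodule.mem_top
  · -- `w₀` is a unit: `λ₁ ∘ Tr` is onto, so `w₀·λ₂(x) ≡ 1` for some `x`
    obtain ⟨y, hy⟩ := hsurj₁ 1
    obtain ⟨x, hx⟩ := unitBallTrace_surjective h hE₂ hπ y
    have h1 : 1 - lam₁ (unitBallTrace h x₁) * lam₂ x ∈ Ideal.span {1 - u ^ Module.finrank F E₁} := by
      have h2 := hcong x
      rwa [hx, hy] at h2
    have hw : IsUnit (lam₁ (unitBallTrace h x₁)) := by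
      by_contra hnu
      have hmax : lam₁ (unitBallTrace h x₁) * lam₂ x ∈ 𝓂[F] := Ideal.mul_mem_right _ _ ((IsLocalRing.mem_maximalIdeal _).mpr hnu)
      have hmax' : 1 - u ^ Module.finrank F E₁ ∈ 𝓂[F] := (IsLocalRing.mem_maximalIdeal _).mpr hunit
      have hspan : Ideal.span {1 - u ^ Module.finrank F E₁} ≤ 𝓂[F] := (Ideal.span_singleton_le_iff_mem _).mpr hmax'
      have h3 : (1 : 𝒪[F]) ∈ 𝓂[F] := by
        have e : (1 : 𝒪[F]) = (1 - lam₁ (unitBallTrace h x₁) * lam₂ x) + lam₁ (unitBallTrace h x₁) * lam₂ x := by ring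
        rw [e]
        exact add_mem (hspan h1) hmax
      exact (Ideal.ne_top_iff_one _).mp (Ideal.IsMaximal.ne_top inferInstance) h3
    exact ⟨hw.unit, fun x => by rw [IsUnit.unit_spec]; exact hcong x⟩

/-! ### The limit of the cokernels is cyclic over `𝒪_F` -/

omit [ValuativeRel F] [TopologicalSpace F] [IsNonarchimedeanLocalField F] in
/-- Closedness of a congruence class `{a : a ≡ b (mod α)}` in the compact `𝒪_F`. [folklore] -/
private theorem isClosed_setOf_sub_mem_span {R : Type*} [CommRing R] [TopologicalSpace R] [IsTopologicalRing R] [CompactSpace R] [T2Space R]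
    (α b : R) : IsClosed {a : R | a - b ∈ Ideal.span {α}} := by
  have hc : Continuous fun t : R => b + t * α := continuous_const.add (continuous_id.mul continuous_const)
  have e : {a : R | a - b ∈ Ideal.span {α}} = Set.range fun t : R => b + t * α := by
    ext a
    simp only [Set.mem_setOf_eq, Set.mem_range, Ideal.mem_span_singleton']
    constructor
    · rintro ⟨t, ht⟩; exact ⟨t, by rw [ht, add_sub_cancel]⟩
    · rintro ⟨t, ht⟩; exact ⟨t, by rw [← ht, add_sub_cancel_left]⟩
  rw [e]
  exact (isCompact_range hc).isClosed

variable (E : ℕ → IntermediateField F (AlgebraicClosure F)) [∀ m, FiniteDimensional F (E m)] [∀ m, IsGalois F (E m)]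
  (hmono : Monotone E) (hE : ∀ m, E m ≤ maxUnramified F)

include hπ hE in
set_option maxHeartbeats 800000 in
/-- ★★★ **The limit of the cokernels of Theorem I.3.7 over the unramified tower is CYCLIC over `𝒪_F`** (`E₀ ≤ E₁ ≤ ⋯ ⊆ F^{nr}` finite Galois,
`σ₀` an arithmetic Frobenius, `u ∈ 𝒪_F` with `u^{[E_m:F]} ≠ 1` for all `m`): there is a family `g = (g_m ∈ 𝒪_{E_m})_m`, trace-coherent modulo
the `(1 − uφ)𝒪_{E_m}`, such that every family `c = (c_m)` trace-coherent modulo the `(1 − uφ)𝒪_{E_m}` satisfies `c_m ≡ a·g_m (mod (1 − uφ)𝒪_{E_m})`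
for all `m`, for ONE scalar `a ∈ 𝒪_F`.  Proof: transport to `lim←_m 𝒪_F/(1 − u^{d_m})` by the functionals `λ_m` (transitions = unit multiples
`w_m` of the projections, `exists_unit_functional_transition`), rescale the generators `λ_m⁻¹(1)` by `(w₀⋯w_{m−1})⁻¹`, and find the scalar in
`⋂_M {a ≡ a_M (mod 1 − u^{d_M})} ≠ ∅` (Cantor, `𝒪_F` compact). [cite: deShalit1987, Ch. I §3.8 (17); Ch. III §1.10] -/
theorem exists_generator_cokernel_limit {σ₀ : absoluteGaloisGroup F} (hσ₀ : IsAbsArithFrob σ₀) (u : 𝒪[F])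
    (hud : ∀ m, 1 - u ^ Module.finrank F (E m) ≠ 0) :
    ∃ g : ∀ m, unitBall (E m),
      (∀ m, ∃ d : unitBall (E m), unitBallTrace (hmono (Nat.le_succ m)) (g (m + 1)) - g m =
        d - algebraMap 𝒪[F] (unitBall (E m)) u * (frobUnitBall (E m) σ₀ : unitBall (E m) →+* unitBall (E m)) d) ∧
      ∀ c : ∀ m, unitBall (E m),
        (∀ m, ∃ d : unitBall (E m), unitBallTrace (hmono (Nat.le_succ m)) (c (m + 1)) - c m =
          d - algebraMap 𝒪[F] (unitBall (E m)) u * (frobUnitBall (E m) σ₀ : unitBall (E m) →+* unitBall (E m)) d) →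
        ∃ a : 𝒪[F], ∀ m, ∃ d : unitBall (E m), c m - a • g m =
          d - algebraMap 𝒪[F] (unitBall (E m)) u * (frobUnitBall (E m) σ₀ : unitBall (E m) →+* unitBall (E m)) d := by
  classical
  -- the functionals of every level
  have hlam := fun m => exists_functional_anomaly_cokernel hπ (E m) (hE m) hσ₀ u (hud m)
  choose lam hsurj hiff using hlam
  -- the annihilators `1 − u^{d_m}` decrease; they act into `(1 − uφ)𝒪_{E_m}`
  have hαdvd : ∀ m j, 1 - u ^ Module.finrank F (E m) ∣ 1 - u ^ Module.finrank F (E (m + j)) := fun m j =>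
    one_sub_pow_finrank_dvd (hmono (Nat.le_add_right m j)) u
  have hαK : ∀ m (y : unitBall (E m)), ∃ d : unitBall (E m), (1 - u ^ Module.finrank F (E m)) • y =
      d - algebraMap 𝒪[F] (unitBall (E m)) u * (frobUnitBall (E m) σ₀ : unitBall (E m) →+* unitBall (E m)) d := fun m y =>
    (hiff m _).mpr (by rw [map_smul, smul_eq_mul]; exact Ideal.mul_mem_right _ _ (Ideal.mem_span_singleton_self _))
  -- the unit transition factors
  have hw := fun m => exists_unit_functional_transition hπ (hmono (Nat.le_succ m)) (hE (m + 1)) σ₀ u (hsurj m) (hiff m)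
    (hsurj (m + 1)) (hiff (m + 1))
  choose w hw using hw
  -- generators: `e_m` with `λ_m e_m = 1`, rescaled by `W_m⁻¹ = (w₀⋯w_{m−1})⁻¹`
  have he := fun m => hsurj m 1
  choose e he using he
  obtain ⟨W, hW⟩ : ∃ W : ℕ → 𝒪[F]ˣ, ∀ m, W m = ∏ i ∈ Finset.range m, w i := ⟨_, fun m => rfl⟩
  have hWsucc : ∀ m, W (m + 1) = W m * w m := fun m => by rw [hW, hW, Finset.prod_range_succ]
  have hWsucc' : ∀ m, (W (m + 1) : 𝒪[F]) = W m * w m := fun m => by rw [hWsucc, Units.val_mul]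
  refine ⟨fun m => (((W m)⁻¹ : 𝒪[F]ˣ) : 𝒪[F]) • e m, fun m => ?_, fun c hc => ?_⟩
  · -- compatibility of `g`: `λ_m(Tr g_{m+1} − g_m) = W_{m+1}⁻¹(λ_m(Tr e_{m+1}) − w_m) + (W_{m+1}⁻¹ w_m − W_m⁻¹)`, the last bracket `= 0`
    refine (hiff m _).mpr ?_
    have h1 := hw m (e (m + 1))
    rw [he, mul_one] at h1
    have e1 : lam m (unitBallTrace (hmono (Nat.le_succ m)) ((((W (m + 1))⁻¹ : 𝒪[F]ˣ) : 𝒪[F]) • e (m + 1)) -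
        (((W m)⁻¹ : 𝒪[F]ˣ) : 𝒪[F]) • e m) =
        (((W (m + 1))⁻¹ : 𝒪[F]ˣ) : 𝒪[F]) * (lam m (unitBallTrace (hmono (Nat.le_succ m)) (e (m + 1))) - (w m : 𝒪[F])) +
          ((((W (m + 1))⁻¹ : 𝒪[F]ˣ) : 𝒪[F]) * (w m : 𝒪[F]) - (((W m)⁻¹ : 𝒪[F]ˣ) : 𝒪[F])) := by
      rw [map_sub, LinearMap.map_smul_of_tower, map_smul, map_smul, he, smul_eq_mul, smul_eq_mul, mul_one]
      ring
    have e2 : (((W (m + 1))⁻¹ : 𝒪[F]ˣ) : 𝒪[F]) * (w m : 𝒪[F]) - (((W m)⁻¹ : 𝒪[F]ˣ) : 𝒪[F]) = 0 := by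
      rw [sub_eq_zero, ← Units.val_mul, hWsucc, mul_inv_rev, mul_comm, mul_inv_cancel_left]
    rw [e1, e2, add_zero]
    exact Ideal.mul_mem_left _ _ h1
  · -- the scalars `A_m = λ_m(c_m)·W_m`, `c_m ≡ A_m • g_m`
    obtain ⟨A, hA⟩ : ∃ A : ℕ → 𝒪[F], ∀ m, A m = lam m (c m) * W m := ⟨_, fun m => rfl⟩
    have hcA : ∀ m, ∃ d : unitBall (E m), c m - A m • ((((W m)⁻¹ : 𝒪[F]ˣ) : 𝒪[F]) • e m) =
        d - algebraMap 𝒪[F] (unitBall (E m)) u * (frobUnitBall (E m) σ₀ : unitBall (E m) →+* unitBall (E m)) d := by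
      intro m
      refine (hiff m _).mpr ?_
      have e1 : lam m (c m - A m • ((((W m)⁻¹ : 𝒪[F]ˣ) : 𝒪[F]) • e m)) = 0 := by
        rw [map_sub, map_smul, map_smul, he, hA, smul_eq_mul, smul_eq_mul, mul_one, mul_assoc, Units.mul_inv, mul_one, sub_self]
      rw [e1]
      exact zero_mem _
    -- compatibility of the scalars: `A_{m+1} ≡ A_m (mod 1 − u^{d_m})`
    have hAsucc : ∀ m, A (m + 1) - A m ∈ Ideal.span {1 - u ^ Module.finrank F (E m)} := by
      intro m
      have h1 : lam m (unitBallTrace (hmono (Nat.le_succ m)) (c (m + 1))) - lam m (c m) ∈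
          Ideal.span {1 - u ^ Module.finrank F (E m)} := by
        rw [← map_sub]; exact (hiff m _).mp (hc m)
      have h2 := hw m (c (m + 1))
      have e1 : A (m + 1) - A m = (W m : 𝒪[F]) * -(lam m (unitBallTrace (hmono (Nat.le_succ m)) (c (m + 1))) -
          (w m : 𝒪[F]) * lam (m + 1) (c (m + 1))) +
          (W m : 𝒪[F]) * (lam m (unitBallTrace (hmono (Nat.le_succ m)) (c (m + 1))) - lam m (c m)) := by
        rw [hA, hA, hWsucc']; ring
      rw [e1]
      exact add_mem (Ideal.mul_mem_left _ _ (neg_mem h2)) (Ideal.mul_mem_left _ _ h1)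
    have hAle : ∀ m j, A (m + j) - A m ∈ Ideal.span {1 - u ^ Module.finrank F (E m)} := by
      intro m j
      induction j with
      | zero => rw [Nat.add_zero, sub_self]; exact zero_mem _
      | succ j ih =>
        have e1 : A (m + (j + 1)) - A m = (A (m + j + 1) - A (m + j)) + (A (m + j) - A m) := by rw [← Nat.add_assoc]; ring
        rw [e1]
        exact add_mem (Ideal.span_singleton_le_span_singleton.mpr (hαdvd m j) (hAsucc (m + j))) ih
    -- one scalar `a ≡ A_m (mod 1 − u^{d_m})` for all `m` (Cantor in the compact `𝒪_F`)
    obtain ⟨T, hT⟩ : ∃ T : ℕ → Set 𝒪[F], ∀ M, T M = {a | ∀ m ≤ M, a - A m ∈ Ideal.span {1 - u ^ Module.finrank F (E m)}} :=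
      ⟨_, fun M => rfl⟩
    have hclosed : ∀ M, IsClosed (T M) := by
      intro M
      have e1 : T M = ⋂ m, ⋂ (_ : m ≤ M), {a : 𝒪[F] | a - A m ∈ Ideal.span {1 - u ^ Module.finrank F (E m)}} := by
        rw [hT]; ext a; simp only [Set.mem_setOf_eq, Set.mem_iInter]
      rw [e1]
      exact isClosed_iInter fun m => isClosed_iInter fun _ => isClosed_setOf_sub_mem_span _ (A m)
    have hne : ∀ M, (T M).Nonempty := by
      intro M
      refine ⟨A M, ?_⟩
      rw [hT]
      intro m hm
      obtain ⟨j, rfl⟩ := Nat.exists_eq_add_of_le hm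
      exact hAle m j
    have hanti : ∀ M, T (M + 1) ⊆ T M := by
      intro M a ha
      rw [hT] at ha ⊢
      exact fun m hm => ha m (Nat.le_succ_of_le hm)
    obtain ⟨a, ha⟩ := IsCompact.nonempty_iInter_of_sequence_nonempty_isCompact_isClosed T hanti hne (hclosed 0).isCompact hclosed
    rw [Set.mem_iInter] at ha
    refine ⟨a, fun m => ?_⟩
    have ham : a - A m ∈ Ideal.span {1 - u ^ Module.finrank F (E m)} := by
      have h1 := ha m
      rw [hT] at h1
      exact h1 m le_rfl
    obtain ⟨t, ht⟩ := Ideal.mem_span_singleton'.mp ham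
    obtain ⟨d₁, hd₁⟩ := hcA m
    obtain ⟨d₂, hd₂⟩ := hαK m (t • ((((W m)⁻¹ : 𝒪[F]ˣ) : 𝒪[F]) • e m))
    have e1 : c m - a • ((((W m)⁻¹ : 𝒪[F]ˣ) : 𝒪[F]) • e m) = (c m - A m • ((((W m)⁻¹ : 𝒪[F]ˣ) : 𝒪[F]) • e m)) -
        (1 - u ^ Module.finrank F (E m)) • (t • ((((W m)⁻¹ : 𝒪[F]ˣ) : 𝒪[F]) • e m)) := by
      rw [smul_smul (1 - u ^ Module.finrank F (E m)) t, mul_comm (1 - u ^ Module.finrank F (E m)) t, ht, sub_smul,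
        sub_sub_sub_cancel_right]
    rw [e1]
    exact exists_sub_eq_sub_algebraMap_mul_frob σ₀ u ⟨d₁, hd₁⟩ ⟨d₂, hd₂⟩

end TwoVariableCokernelTwo

end Literature.NumberTheory.GaloisRepresentations
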